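import Summits.ABC.ABC.Theses.RibetTakahashiSplit
import Summits.ABC.ABC.Theorems.RibetTakahashiSplitOmegaLiftAssembly
import HarnessLib

/-!
# Route RibetTakahashiSplit — decl `Assembly2` (now item stmt-ABC-15513, `OmegaLiftAssembly`)

The route decl `Summit.ABC.ABC.Theses.RibetTakahashiSplit.Assembly2` currently reads

> `ManyPrimeValuationProductSemistableFrey → WeightedSzpiroBound → ABC`

(the ω-lift assembly, item stmt-ABC-15513; the gate's LINT AUTOFIX of 2026-08-16T14:15:59Z re-pointed
the decl, which until then carried the rev-6 chain
`ManyPrimeValuationProductFrey → FewPrimeValuationProduct → WeightedSzpiroBound → ABC` of the dropped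
item stmt-ABC-15150 — that chain stays proved as `Summit.ABC.ABC.Theorems.abc_of_manyPrimeFreyClass`,
`Theorems/RibetTakahashiSplitManyPrimeValuationProductFreyClassSuffices.lean`, and the old proof in this
file no longer elaborated against the re-pointed decl).

The current statement is proved on the nose by the accepted theorem
`Summit.ABC.ABC.Theorems.omegaLiftAssembly_proof` (`Theorems/RibetTakahashiSplitOmegaLiftAssembly.lean`,
p113013/p114622: discard the first hypothesis and apply `WeightedSzpiroBound.abc_of` to the second —
the weighted Szpiro bound r3′ alone already gives `ABC`, `WeightedSzpiroBound.iff_abc`); this file only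
re-targets that theorem at the route decl, so that the item can be closed by name.

Nothing else is in this file (no definitions, no named facts).
-/

namespace Summit.ABC.ABC.Theses.RibetTakahashiSplit
/-- **Record of the dropped route item `Assembly2`** = stmt-ABC-15513 (ledger signature verbatim; NOT a route
item): route RibetTakahashiSplit (2026-08-17T04:22Z) dropped the proved `Assembly2` (stmt-15513) when the assembly was re-cut. The declaration `Summit.ABC.ABC.Theses.RibetTakahashiSplit.Assembly2`
therefore no longer exists in the route file and this accepted module stopped elaborating (stale olean;
buildfix lane 2026-08-19). Re-created here under its original name so the result keeps building; the
statement of every previously accepted declaration in this file is unchanged. -/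
def Assembly2 : Prop :=
  ManyPrimeValuationProductSemistableFrey → WeightedSzpiroBound → _root_.ABC
end Summit.ABC.ABC.Theses.RibetTakahashiSplit


-- `Summit.<Summit>.<Problem>` is the mandated summit-side namespace (CONVENTIONS §2); for the
-- single-conjunct summit `ABC` the two coincide, so the duplicate `ABC.ABC` is deliberate.
set_option linter.dupNamespace false

noncomputable section

namespace Summit.ABC.ABC.Theorems

/-- **Decl `Assembly2` of route RibetTakahashiSplit (item stmt-ABC-15513, `OmegaLiftAssembly`), proved.**
`ManyPrimeValuationProductSemistableFrey → WeightedSzpiroBound → ABC` is literally the type of the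
accepted `omegaLiftAssembly_proof` once the route definition is unfolded (definitional, no tactic needed).
[folklore] -/
theorem ribetTakahashiSplit_assembly2_proof :
    Summit.ABC.ABC.Theses.RibetTakahashiSplit.Assembly2 :=
  omegaLiftAssembly_proof

end Summit.ABC.ABC.Theorems

end
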